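import Mathlib.MeasureTheory.Measure.Portmanteau
import Literature.Probability.RandomPlanarGeometry.HexSAW
import Literature.Probability.RandomPlanarGeometry.ConformalRestrictionProofs
import Literature.Probability.RandomPlanarGeometry.CritPercSLESimplePathHolds
import Literature.Probability.RandomPlanarGeometry.SimpleCurves
import Literature.Probability.RandomPlanarGeometry.WeaklySAW
import HarnessLib

/-!
# Crux `HexTransfer` (stmt-CriticalPhenomena-14221), line `yb-relay`: under DCS Conjecture 1 the
# critical hexagonal SAW does not return near its starting point after reaching a fixed distance

Landing target: `Summits/CriticalPhenomena/SAWScalingLimit/Theorems/SAWDevelopingMapHexTransferNoReturnToStart.lean`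
(`--supports stmt-CriticalPhenomena-14221`; registered sub-goal `hex_noReturnToStart_of_hexSAWScalingLimit`,
groundwork for the research stub `stub_hexFaceRobust`; twin of
`hex_noBoundaryCreep_of_hexSAWScalingLimit` in `…HexTransferNoBoundaryCreep.lean`).

Statement: granted `HexSAWScalingLimit` (A), for every Dobrushin domain `(D; a, b)`, hexagonal endpoint
approximation, `R > 0` and `ε > 0` there is `r > 0` such that, for all small meshes `δ`, the critical
hexagonal SAW of `(D_δ; a_δ, b_δ)` has probability `≤ ε` of being at some time at distance `≥ R` from
the first marked point `a = D.pt 0` and at a LATER time within distance `r` of it.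

Proof. For a curve `γ` write `P_r(γ)` for "there are times `t₁ ≤ t₂` with `R ≤ dist (γ t₁) a` and
`dist (γ t₂) a ≤ r`", and `E_r` for the set of curve classes having a representative with `P_r`.
* (compactness, `exists_farNear_of_forall_approx`) if `γ` has, for every `n`, times `s₁ ≤ s₂` with
  `R - 1/(n+1) ≤ dist (γ s₁) a` and `dist (γ s₂) a ≤ r + 1/(n+1)`, then `P_r(γ)`: a subsequence of
  `(s₁ⁿ, s₂ⁿ)` converges in the compact square `[0,1]²` and `γ` is continuous;
* (uniform closeness, `exists_farNear_approx_of_dist_lt`) if `dist γ γ₀ < η` and `P_r(γ)` then `γ₀` has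
  such approximate times with error `η` (Aizenman–Burchard: a reparametrisation of `γ₀` is uniformly
  `η`-close to `γ`, `Curve.exists_dist_reparam_lt`; reparametrisations are monotone);
* hence `P_r` does not depend on the representative (`farNear_of_mk_eq_mk`) and `E_r` is CLOSED in
  `CurveClass ℂ` (`isClosed_setOf_farNear`);
* the SLE(8/3) limit law `μ` of (A) gives `⋂ₙ E_{1/(n+1)}` mass `0`: `μ`-a.e. class is simple
  (`IsSLELaw.ae_simple`, Rohde–Schramm Thm 6.1, discharged in the tree) and starts at `a`
  (`ae_source_eq_of_isSLELaw`: the SLE trace starts at `W₀ = 0 ↦ a`); for an injective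
  representative `γ₀` with `γ₀ 0 = a`, `P_{1/(n+1)}(γ₀)` for all `n` forces (compactness again) times
  `t₁ ≤ t₂` with `R ≤ dist (γ₀ t₁) a` and `γ₀ t₂ = a = γ₀ 0`, so `t₂ = 0 = t₁`, contradicting `R > 0`;
* continuity from above gives `N` with `μ(E_{1/(N+1)}) ≤ ε/2`, and the portmanteau theorem
  (`ProbabilityMeasure.limsup_measure_closed_le_of_tendsto`) applied to the hexagonal laws pushed to
  `CurveClass ℂ` (probability measures for small `δ`, by (A) tested against the constant `1`) bounds
  `limsup_δ P_δ(E_{1/(N+1)}) ≤ ε/2 < ε`.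
-/

noncomputable section

namespace Summit.CriticalPhenomena.SAWScalingLimit.Cruxes.HexTransfer.YbRelay

open MeasureTheory Filter Topology Set Metric
open scoped NNReal ENNReal BoundedContinuousFunction
open Literature.Probability.RandomPlanarGeometry
open Literature.Probability.RandomPlanarGeometry.SAW
open Literature.Probability.LatticeModels (HexVertex hexGraph hexCenter)
open Literature.Probability (Process.preWienerMeasure)

/-! ### Times far from / near a point: compactness and transfer between close curves -/

/-- Compactness of `[0,1]²`: if a curve `γ` has, for every `n`, times `s₁ ≤ s₂` with
`R - 1/(n+1) ≤ dist (γ s₁) a` and `dist (γ s₂) a ≤ r + 1/(n+1)`, then it has times `t₁ ≤ t₂` with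
`R ≤ dist (γ t₁) a` and `dist (γ t₂) a ≤ r` (subsequential limits of the times, continuity of `γ`).
[folklore] -/
theorem exists_farNear_of_forall_approx (γ : Curve ℂ) (a : ℂ) (R r : ℝ)
    (h : ∀ n : ℕ, ∃ s₁ s₂ : unitInterval, s₁ ≤ s₂ ∧ R - 1 / ((n : ℝ) + 1) ≤ dist (γ s₁) a ∧
      dist (γ s₂) a ≤ r + 1 / ((n : ℝ) + 1)) :
    ∃ t₁ t₂ : unitInterval, t₁ ≤ t₂ ∧ R ≤ dist (γ t₁) a ∧ dist (γ t₂) a ≤ r := by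
  choose s₁ s₂ hs using h
  obtain ⟨q, ψ, hψ, hlim⟩ := CompactSpace.tendsto_subseq fun n => (s₁ n, s₂ n)
  have h1 : Tendsto (fun k => s₁ (ψ k)) atTop (𝓝 q.1) := (continuous_fst.tendsto q).comp hlim
  have h2 : Tendsto (fun k => s₂ (ψ k)) atTop (𝓝 q.2) := (continuous_snd.tendsto q).comp hlim
  have h0 : Tendsto (fun n : ℕ => 1 / ((n : ℝ) + 1)) atTop (𝓝 0) :=
    tendsto_one_div_add_atTop_nhds_zero_nat
  have hη : Tendsto (fun k : ℕ => 1 / ((ψ k : ℝ) + 1)) atTop (𝓝 0) := h0.comp hψ.tendsto_atTop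
  refine ⟨q.1, q.2, ?_, ?_, ?_⟩
  · exact le_of_tendsto_of_tendsto h1 h2 (Eventually.of_forall fun k => (hs (ψ k)).1)
  · have hc : Tendsto (fun k => dist (γ (s₁ (ψ k))) a) atTop (𝓝 (dist (γ q.1) a)) :=
      ((γ.continuous.dist continuous_const).tendsto q.1).comp h1
    have hR : Tendsto (fun k : ℕ => R - 1 / ((ψ k : ℝ) + 1)) atTop (𝓝 R) := by
      simpa using tendsto_const_nhds.sub hη
    exact le_of_tendsto_of_tendsto hR hc (Eventually.of_forall fun k => (hs (ψ k)).2.1)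
  · have hc : Tendsto (fun k => dist (γ (s₂ (ψ k))) a) atTop (𝓝 (dist (γ q.2) a)) :=
      ((γ.continuous.dist continuous_const).tendsto q.2).comp h2
    have hr : Tendsto (fun k : ℕ => r + 1 / ((ψ k : ℝ) + 1)) atTop (𝓝 r) := by
      simpa using tendsto_const_nhds.add hη
    exact le_of_tendsto_of_tendsto hc hr (Eventually.of_forall fun k => (hs (ψ k)).2.2)

/-- Transfer along the reparametrisation distance: if `dist γ γ₀ < η` and `γ` has times `t₁ ≤ t₂`
with `R ≤ dist (γ t₁) a`, `dist (γ t₂) a ≤ r`, then `γ₀` has times `s₁ ≤ s₂` with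
`R - η ≤ dist (γ₀ s₁) a`, `dist (γ₀ s₂) a ≤ r + η`: some increasing reparametrisation of `γ₀` is
uniformly `η`-close to `γ` (Aizenman–Burchard 1999, §2.1, `Curve.exists_dist_reparam_lt`). [folklore] -/
theorem exists_farNear_approx_of_dist_lt {γ γ₀ : Curve ℂ} {η : ℝ} (hd : dist γ γ₀ < η) {a : ℂ}
    {R r : ℝ} (h : ∃ t₁ t₂ : unitInterval, t₁ ≤ t₂ ∧ R ≤ dist (γ t₁) a ∧ dist (γ t₂) a ≤ r) :
    ∃ s₁ s₂ : unitInterval, s₁ ≤ s₂ ∧ R - η ≤ dist (γ₀ s₁) a ∧ dist (γ₀ s₂) a ≤ r + η := by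
  obtain ⟨t₁, t₂, ht, hR, hr⟩ := h
  obtain ⟨φ, hφ⟩ := Curve.exists_dist_reparam_lt hd
  have hclose : ∀ t, dist (γ t) (γ₀ (φ t)) < η := fun t => by
    have h1 := ContinuousMap.dist_apply_le_dist (f := γ.toContinuousMap)
      (g := (γ₀.reparam φ).toContinuousMap) (x := t)
    simp only [Curve.coe_toContinuousMap, Curve.reparam_apply] at h1
    exact h1.trans_lt hφ
  refine ⟨φ t₁, φ t₂, φ.monotone ht, ?_, ?_⟩
  · have h3 := dist_triangle (γ t₁) (γ₀ (φ t₁)) a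
    linarith [hclose t₁]
  · have h3 := dist_triangle (γ₀ (φ t₂)) (γ t₂) a
    rw [dist_comm (γ₀ (φ t₂)) (γ t₂)] at h3
    linarith [hclose t₂]

/-- The property "times `t₁ ≤ t₂` with `R ≤ dist (γ t₁) a` and `dist (γ t₂) a ≤ r`" does not depend
on the representative of a curve class (both conditions are closed). [folklore] -/
theorem farNear_of_mk_eq_mk {γ γ₀ : Curve ℂ} (he : CurveClass.mk γ = CurveClass.mk γ₀) {a : ℂ}
    {R r : ℝ} (h : ∃ t₁ t₂ : unitInterval, t₁ ≤ t₂ ∧ R ≤ dist (γ t₁) a ∧ dist (γ t₂) a ≤ r) :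
    ∃ t₁ t₂ : unitInterval, t₁ ≤ t₂ ∧ R ≤ dist (γ₀ t₁) a ∧ dist (γ₀ t₂) a ≤ r := by
  rw [CurveClass.mk_eq_mk_iff_dist_eq_zero] at he
  exact exists_farNear_of_forall_approx γ₀ a R r fun n =>
    exists_farNear_approx_of_dist_lt (by rw [he]; positivity) h

/-- The event "some representative is at distance `≥ R` from `a` at a time and within `r` of `a` at
a later time" is CLOSED in the space of curves modulo reparametrisation. [folklore] -/
theorem isClosed_setOf_farNear (a : ℂ) (R r : ℝ) :
    IsClosed {c : CurveClass ℂ | ∃ γ : Curve ℂ, CurveClass.mk γ = c ∧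
      ∃ t₁ t₂ : unitInterval, t₁ ≤ t₂ ∧ R ≤ dist (γ t₁) a ∧ dist (γ t₂) a ≤ r} := by
  refine isClosed_of_closure_subset fun c hc => ?_
  rw [Metric.mem_closure_iff] at hc
  obtain ⟨γ₀, rfl⟩ := CurveClass.surjective_mk c
  refine ⟨γ₀, rfl, exists_farNear_of_forall_approx γ₀ a R r fun n => ?_⟩
  obtain ⟨c', ⟨γ, hγc', hγ⟩, hdist⟩ := hc (1 / ((n : ℝ) + 1)) (by positivity)
  rw [← hγc', CurveClass.dist_mk_mk, dist_comm] at hdist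
  exact exists_farNear_approx_of_dist_lt hdist hγ

/-- A simple curve started at `a` cannot, for every `n`, be at distance `≥ R > 0` from `a` and later
within `1/(n+1)` of `a`: in the limit it would return exactly to `a = γ₀ 0` at a time `t₂ ≥ t₁`,
forcing `t₁ = t₂ = 0`. [folklore] -/
theorem not_forall_farNear_of_isSimple {γ₀ : Curve ℂ} (hinj : γ₀.IsSimple) {a : ℂ}
    (h0 : γ₀.source = a) {R : ℝ} (hR : 0 < R)
    (h : ∀ n : ℕ, ∃ t₁ t₂ : unitInterval, t₁ ≤ t₂ ∧ R ≤ dist (γ₀ t₁) a ∧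
      dist (γ₀ t₂) a ≤ 1 / ((n : ℝ) + 1)) : False := by
  obtain ⟨t₁, t₂, ht, hR', hr⟩ := exists_farNear_of_forall_approx γ₀ a R 0 fun n => by
    obtain ⟨t₁, t₂, ht, h1, h2⟩ := h n
    have hpos : (0 : ℝ) < 1 / ((n : ℝ) + 1) := by positivity
    exact ⟨t₁, t₂, ht, by linarith, by linarith⟩
  have ha : γ₀ 0 = a := (Curve.source_def γ₀).symm.trans h0
  have h2 : γ₀ t₂ = γ₀ 0 := by
    rw [ha]
    exact dist_le_zero.1 hr
  have ht2 : t₂ = 0 := hinj h2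
  have ht1 : t₁ = 0 := le_antisymm (ht.trans_eq ht2) bot_le
  rw [ht1, ha, dist_self] at hR'
  exact absurd hR' (not_le.2 hR)

/-! ### The SLE sample starts at the first marked point -/

/-- For a chordal SLE_κ law `μ` in `(D; a, b)`, `μ`-a.e. curve class starts at `a`: the SLE trace
starts at `W₀ = 0` (`sleTrace_zero`) and the boundary extension of the chordal uniformizing map sends
`0 ↦ a` (`IsChordalUniformizing.boundaryExtension_zero`). (The source half of
`IsSLELaw.ae_endpoints`, which needs no Carathéodory input.) Lawler (2005), §6.3. [folklore] -/
theorem ae_source_eq_of_isSLELaw {κ : ℝ≥0} {D : DobrushinDomain} {μ : Measure (CurveClass ℂ)}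
    (h : IsSLELaw κ D μ) : ∀ᵐ c ∂μ, c.source = D.pt 0 := by
  obtain ⟨Γ, ⟨hΓm, φ, hφ, hae⟩, rfl⟩ := h
  have hmeas : MeasurableSet {c : CurveClass ℂ | c.source = D.pt 0} :=
    CurveClass.continuous_source.measurable (measurableSet_singleton _)
  rw [ae_map_iff hΓm hmeas]
  filter_upwards [hae] with ω ⟨_, c, hΓω, hc⟩
  rw [hΓω, CurveClass.source_mk, Curve.source_def, hc.1 0 (by norm_num), rayParam_zero,
    sleTrace_zero, hφ.boundaryExtension_zero]

/-! ### The main statement -/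

/-- **No return near the start under DCS Conjecture 1** (registered sub-goal of line `yb-relay`,
crux stmt-CriticalPhenomena-14221; groundwork for `stub_hexFaceRobust`): granted
`HexSAWScalingLimit`, for every Dobrushin domain, hexagonal endpoint approximation, `R > 0` and
`ε > 0` there is `r > 0` such that for all small `δ` the critical hexagonal SAW law gives mass `≤ ε`
to the walks whose drawn curve is at some time at distance `≥ R` from the first marked point and at
a later time within `r` of it. [folklore] -/
theorem hex_noReturnToStart_of_hexSAWScalingLimit : HexSAWScalingLimit → ∀ (D : DobrushinDomain) (a b : ℝ → HexVertex), IsEmbEndpointApprox hexGraph hexCenter D a b → ∀ R : ℝ, 0 < R → ∀ ε : ℝ, 0 < ε → ∃ r : ℝ, 0 < r ∧ ∀ᶠ δ in 𝓝[>] (0 : ℝ), hexSAWLaw D.carrier δ (a δ) (b δ) {γ | ∃ c : Curve ℂ, CurveClass.mk c = γ.curve ∧ ∃ t₁ t₂ : unitInterval, t₁ ≤ t₂ ∧ R ≤ dist (c t₁) (D.pt 0) ∧ dist (c t₂) (D.pt 0) ≤ r} ≤ ENNReal.ofReal ε := by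
  classical
  intro hA D a b hab R hR ε hε
  haveI := isProbabilityMeasure_preWienerMeasure'
  obtain ⟨Γ, hΓ, -, hT⟩ := hA D a b hab
  -- the closed events `E r`
  let E : ℝ → Set (CurveClass ℂ) := fun r => {c | ∃ γ : Curve ℂ, CurveClass.mk γ = c ∧
    ∃ t₁ t₂ : unitInterval, t₁ ≤ t₂ ∧ R ≤ dist (γ t₁) (D.pt 0) ∧ dist (γ t₂) (D.pt 0) ≤ r}
  have hEcl : ∀ r, IsClosed (E r) := fun r => isClosed_setOf_farNear (D.pt 0) R r
  have hEmeas : ∀ r, MeasurableSet (E r) := fun r => (hEcl r).measurableSet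
  have hEmono : Antitone fun n : ℕ => E (1 / ((n : ℝ) + 1)) := by
    intro m n hmn c hc
    obtain ⟨γ, hγ, t₁, t₂, ht, h1, h2⟩ := hc
    refine ⟨γ, hγ, t₁, t₂, ht, h1, h2.trans ?_⟩
    exact one_div_le_one_div_of_le (by positivity) (by exact_mod_cast Nat.succ_le_succ hmn)
  -- the SLE law does not charge the limiting event
  let μ : Measure (CurveClass ℂ) := Process.preWienerMeasure.map Γ
  haveI hμ : IsProbabilityMeasure μ := Measure.isProbabilityMeasure_map hΓ.aemeasurable
  have hμ0 : μ (⋂ n : ℕ, E (1 / ((n : ℝ) + 1))) = 0 := by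
    have hs := IsSLELaw.ae_simple ae_isSimpleTrace_sleTrace_of_le_four_holds
      CurveClass.measurableSet_simple_holds (by positivity)
      (by rw [div_le_iff₀ (by norm_num : (0 : ℝ≥0) < 3)]; norm_num) hΓ.isSLELaw_map
    have hsrc := ae_source_eq_of_isSLELaw hΓ.isSLELaw_map
    refine measure_mono_null (fun c hc => ?_) (ae_iff.1 (hs.and hsrc))
    simp only [mem_setOf_eq]
    rintro ⟨⟨⟨γ₀, hγ₀, rfl⟩, -⟩, hsrc0⟩
    rw [mem_iInter] at hc
    rw [CurveClass.source_mk] at hsrc0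
    refine not_forall_farNear_of_isSimple hγ₀ hsrc0 hR fun n => ?_
    obtain ⟨γ, hγ, hP⟩ := hc n
    exact farNear_of_mk_eq_mk hγ hP
  -- continuity from above: some `E (1/(N+1))` has SLE-mass `≤ ε/2`
  have hμlim : Tendsto (fun n : ℕ => μ (E (1 / ((n : ℝ) + 1)))) atTop (𝓝 0) := by
    have h := tendsto_measure_iInter_atTop (μ := μ) (fun n => (hEmeas _).nullMeasurableSet) hEmono
      ⟨0, measure_ne_top μ _⟩
    rwa [hμ0] at h
  obtain ⟨N, hN⟩ := (ENNReal.tendsto_atTop_zero.1 hμlim) (ENNReal.ofReal (ε / 2))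
    (ENNReal.ofReal_pos.2 (half_pos hε))
  have hNle : μ (E (1 / ((N : ℝ) + 1))) ≤ ENNReal.ofReal (ε / 2) := hN N le_rfl
  refine ⟨1 / ((N : ℝ) + 1), by positivity, ?_⟩
  -- package the hexagonal laws as probability measures on `CurveClass ℂ` (junk off the good set)
  let Pδ : ∀ δ : ℝ, Measure (HexDomainSAW D.carrier δ (a δ) (b δ)) := fun δ =>
    hexSAWLaw D.carrier δ (a δ) (b δ)
  have hP : ∀ δ, Pδ δ = 0 ∨ IsProbabilityMeasure (Pδ δ) := fun δ =>
    Literature.Probability.RandomPlanarGeometry.WeaklySAW.normalize_dichotomy _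
  have hev : ∀ᶠ δ in 𝓝[>] (0 : ℝ), IsProbabilityMeasure (Pδ δ) := by
    have h1 := hT (BoundedContinuousFunction.const (CurveClass ℂ) 1)
    simp only [BoundedContinuousFunction.const_apply, integral_const, smul_eq_mul, mul_one,
      probReal_univ] at h1
    filter_upwards [h1.eventually (lt_mem_nhds one_half_lt_one)] with δ hδ
    rcases hP δ with h0 | hp
    · simp only [Pδ] at h0
      rw [h0] at hδ
      norm_num at hδ
    · exact hp
  let ν : ProbabilityMeasure (CurveClass ℂ) := ⟨μ, hμ⟩
  let νs : ℝ → ProbabilityMeasure (CurveClass ℂ) := fun δ =>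
    if hδ : IsProbabilityMeasure (Pδ δ) then
      ⟨(Pδ δ).map (fun γ => γ.curve),
        Measure.isProbabilityMeasure_map (EmbDomainSAW.measurable_of_top _).aemeasurable⟩
    else ν
  have hT' : Tendsto νs (𝓝[>] 0) (𝓝 ν) := by
    rw [ProbabilityMeasure.tendsto_iff_forall_integral_tendsto]
    intro f
    have h1 := hT f
    have e2 : ∫ x, f x ∂(ν : Measure (CurveClass ℂ)) = ∫ ω, f (Γ ω) ∂Process.preWienerMeasure :=
      integral_map hΓ.aemeasurable f.continuous.aestronglyMeasurable
    rw [e2]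
    refine h1.congr' ?_
    filter_upwards [hev] with δ hδ
    simp only [νs, dif_pos hδ, ProbabilityMeasure.coe_mk]
    exact (integral_map (EmbDomainSAW.measurable_of_top _).aemeasurable
      f.continuous.aestronglyMeasurable).symm
  have hlimsup := ProbabilityMeasure.limsup_measure_closed_le_of_tendsto hT' (hEcl (1 / ((N : ℝ) + 1)))
  have hlt : limsup (fun δ => (νs δ : Measure (CurveClass ℂ)) (E (1 / ((N : ℝ) + 1)))) (𝓝[>] 0) <
      ENNReal.ofReal ε :=
    lt_of_le_of_lt (hlimsup.trans hNle) ((ENNReal.ofReal_lt_ofReal_iff hε).2 (by linarith))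
  filter_upwards [hev, Filter.eventually_lt_of_limsup_lt hlt] with δ hδ h2
  have key : hexSAWLaw D.carrier δ (a δ) (b δ) {γ | ∃ c : Curve ℂ, CurveClass.mk c = γ.curve ∧
      ∃ t₁ t₂ : unitInterval, t₁ ≤ t₂ ∧ R ≤ dist (c t₁) (D.pt 0) ∧
        dist (c t₂) (D.pt 0) ≤ 1 / ((N : ℝ) + 1)} =
      (νs δ : Measure (CurveClass ℂ)) (E (1 / ((N : ℝ) + 1))) := by
    simp only [νs, dif_pos hδ, ProbabilityMeasure.coe_mk]
    rw [Measure.map_apply (EmbDomainSAW.measurable_of_top _) (hEmeas _)]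
    rfl
  rw [key]
  exact h2.le

end Summit.CriticalPhenomena.SAWScalingLimit.Cruxes.HexTransfer.YbRelay

end
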